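import Literature.Probability.RandomPlanarGeometry.SAWRestrictionCovariance
import Literature.Probability.RandomPlanarGeometry.SAWExcursionAvoidance
import Mathlib.Analysis.SpecialFunctions.Pow.Real
import HarnessLib

/-!
# Sketch — crux idea `hadamard-touching` for `ForwardDriving` (stmt-CriticalPhenomena-18003)

The boundary-touching observable of the critical `δℤ²` SAW: `O(B) = P[γ meets the obstacle B]`.
Because the SAW law is an exact lattice restriction family, `1 - O(B) = Z_{Ω∖B}/Z_Ω` (one-obstacle
Hadamard variation of `log Z`), so obstacle removals COMMUTE exactly; conditionally on a prefix it is
a defect-free Doob martingale; and its yardstick is the random-walk excursion's touching probability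
`1 - avoidRatio` in the same discrete domain.  First lemmas of the line, typed over existing
declarations (`SAW.law`, `SAW.weight`, `SAW.DomainSAW`, `SRWExcursion.avoidRatio`,
`discreteDomainGraph`, `meshPoint`).  Sorries mark statements, not gaps in definitions.
-/

noncomputable section

open MeasureTheory Set Filter
open scoped ENNReal Topology
open Literature.Probability.LatticeModels Literature.Probability.RandomPlanarGeometry

namespace Summit.CriticalPhenomena.SAWScalingLimit.Theses.SAWReversalUpgrade.HadamardTouching

/-- The touching probability of the obstacle `B ⊆ ℂ` by the critical SAW of `Ω_δ` from `u` to `v`: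
the `SAW.law`-mass of walks having a vertex whose mesh point lies in `B`. -/
def touchProb (Ω B : Set ℂ) (δ : ℝ) (u v : Site 2) : ℝ :=
  ((SAW.law Ω δ u v) {γ | ∃ w ∈ γ.walk.support, meshPoint δ w ∈ B}).toReal

/-- The random-walk yardstick: probability that the excursion of `Ω_δ` from `u` to `v` (killed right
after `v`) meets the obstacle `B` — one minus the tree's `avoidRatio`. -/
def excTouchProb (Ω B : Set ℂ) (δ : ℝ) (u v : Site 2) : ℝ :=
  1 - SRWExcursion.avoidRatio (discreteDomainGraph Ω δ) u v {w | meshPoint δ w ∈ B}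

/-- **First lemma (A), exact Hadamard form.** Under nesting of `(Ω∖B)_δ` in `Ω_δ` and for a genuine
partition function `0 < Z < ∞`, NOT touching `B` is the confinement event of the smaller discrete
domain, so `1 - touchProb = Z_{Ω∖B}/Z_Ω` — the SAW instance of `law_setOf_exists_support_eq_eq`
once the two events are identified (the identification needs `B` to be a union of closed mesh cells /
a closed ball so that "no vertex in `B`" ⇔ "is a walk of `(Ω∖B)_δ`"; stated here as a hypothesis). -/
theorem one_sub_touchProb_eq_ratio (Ω B : Set ℂ) (δ : ℝ) (u v : Site 2)
    (hN : ∀ γ' : SAW.DomainSAW (Ω \ B) δ u v,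
      ∃ γ : SAW.DomainSAW Ω δ u v, γ.walk.support = γ'.walk.support)
    (hB : ∀ γ : SAW.DomainSAW Ω δ u v,
      (¬ ∃ w ∈ γ.walk.support, meshPoint δ w ∈ B) ↔
        ∃ γ' : SAW.DomainSAW (Ω \ B) δ u v, γ'.walk.support = γ.walk.support)
    (h0 : SAW.weight Ω δ u v Set.univ ≠ 0) (htop : SAW.weight Ω δ u v Set.univ ≠ ∞) :
    1 - touchProb Ω B δ u v =
      ((SAW.weight Ω δ u v Set.univ)⁻¹ * SAW.weight (Ω \ B) δ u v Set.univ).toReal := by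
  sorry

/-- **First lemma (B), commutation of obstacle removals** (symmetric second Hadamard variation; exact,
no limit): removing `B₁` then `B₂` or `B₂` then `B₁` gives the same product of survival factors,
because both equal `Z_{Ω∖(B₁∪B₂)}/Z_Ω`. This is the identity that, read against the conformal
geometry of far bumps (influence of an `ε`-bump = `O(ε²)`), forces the touching exponent `θ = 2`. -/
theorem touchProb_commute (Ω B₁ B₂ : Set ℂ) (δ : ℝ) (u v : Site 2)
    (hN₁ : ∀ γ' : SAW.DomainSAW (Ω \ B₁) δ u v,
      ∃ γ : SAW.DomainSAW Ω δ u v, γ.walk.support = γ'.walk.support)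
    (hN₂ : ∀ γ' : SAW.DomainSAW (Ω \ B₂) δ u v,
      ∃ γ : SAW.DomainSAW Ω δ u v, γ.walk.support = γ'.walk.support)
    (hN₁₂ : ∀ γ' : SAW.DomainSAW ((Ω \ B₁) \ B₂) δ u v,
      ∃ γ : SAW.DomainSAW (Ω \ B₁) δ u v, γ.walk.support = γ'.walk.support)
    (hN₂₁ : ∀ γ' : SAW.DomainSAW ((Ω \ B₂) \ B₁) δ u v,
      ∃ γ : SAW.DomainSAW (Ω \ B₂) δ u v, γ.walk.support = γ'.walk.support)
    (h0 : SAW.weight Ω δ u v Set.univ ≠ 0) (htop : SAW.weight Ω δ u v Set.univ ≠ ∞) :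
    (1 - touchProb Ω B₁ δ u v) * (1 - touchProb (Ω \ B₁) B₂ δ u v) =
      (1 - touchProb Ω B₂ δ u v) * (1 - touchProb (Ω \ B₂) B₁ δ u v) := by
  sorry

/-- **First lemma (C), the conditional touching observable is a defect-free martingale** (tower
identity on the finite SAW space, the analogue of the strategist's `targetRN_step` with NO defect
term: it is the conditional probability of ONE fixed event under ONE law). Averaging the
`(n+1)`-prefix conditional touching probability over the `n`-cylinder of `γ` returns the joint mass
of the `n`-cylinder and the touching event. -/
theorem condTouch_tower (Ω B : Set ℂ) (δ : ℝ) (u v : Site 2) [Finite (SAW.DomainSAW Ω δ u v)]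
    (γ : SAW.DomainSAW Ω δ u v) (n : ℕ) :
    ∫ ω in {ω : SAW.DomainSAW Ω δ u v | ω.walk.support.take (n + 1) = γ.walk.support.take (n + 1)},
        ((SAW.law Ω δ u v) {ζ | ζ.walk.support.take (n + 2) = ω.walk.support.take (n + 2) ∧
            ∃ w ∈ ζ.walk.support, meshPoint δ w ∈ B}).toReal /
          ((SAW.law Ω δ u v) {ζ | ζ.walk.support.take (n + 2) = ω.walk.support.take (n + 2)}).toReal
        ∂(SAW.law Ω δ u v) =
      ((SAW.law Ω δ u v) {ζ | ζ.walk.support.take (n + 1) = γ.walk.support.take (n + 1) ∧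
          ∃ w ∈ ζ.walk.support, meshPoint δ w ∈ B}).toReal := by
  sorry

/-- **The θ = 2 forcing, as pure algebra.** If touching an `ε`-bump scales like `ε^θ` while being
influenced by a far `ε`-bump scales like `ε²` (half-plane capacity order), commutation of two bump
removals equates the cross terms `ε² ε'^θ = ε'² ε^θ` for all small sizes; this holds iff `θ = 2`. -/
theorem theta_eq_two_iff (θ : ℝ) :
    (∀ ε ε' : ℝ, 0 < ε → 0 < ε' → ε ^ (2 : ℝ) * ε' ^ θ = ε' ^ (2 : ℝ) * ε ^ θ) ↔ θ = 2 := by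
  constructor
  · intro h
    have h12 := h 1 2 one_pos two_pos
    simp only [Real.one_rpow, one_mul, mul_one] at h12
    -- `h12 : 2 ^ θ = 2 ^ 2`
    have h2 : (1 : ℝ) < 2 := by norm_num
    apply le_antisymm
    · exact (Real.rpow_le_rpow_left_iff h2).mp h12.le
    · exact (Real.rpow_le_rpow_left_iff h2).mp h12.ge
  · rintro rfl ε ε' _ _
    ring

/-- **Transfer `C⁺` (base case, unconditioned, smooth far boundary): the Hadamard comparison with the
random-walk excursion.** ONE constant `α > 0` such that for every Dobrushin domain, endpoint
approximation and boundary point `z ∉ {a, b}`, the SAW's probability of touching the `ε`-ball at `z`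
is `α` times the excursion's, up to relative error `η`, for `ε < ε₀(η)` and eventually in `δ`.
(Conformal prediction `α = 5/8` against the excursion normalisation; the crux needs the same statement
in the slit domains `Ω ∖ γ[0,n]` from the tip, uniformly over prefixes of capacity `≤ T` — the card's
`C⁺`; this is its `n = 0` case.) -/
def HadamardComparison₀ : Prop :=
  ∃ α : ℝ, 0 < α ∧ ∀ (D : DobrushinDomain) (a b : ℝ → Site 2), SAW.IsEndpointApprox D a b →
    ∀ z ∈ frontier D.carrier, z ≠ D.pt 0 → z ≠ D.pt 1 → ∀ η : ℝ, 0 < η → ∃ ε₀ : ℝ, 0 < ε₀ ∧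
      ∀ ε : ℝ, 0 < ε → ε < ε₀ → ∀ᶠ δ in 𝓝[>] (0 : ℝ),
        |touchProb D.carrier (Metric.closedBall z ε) δ (a δ) (b δ)
            - α * excTouchProb D.carrier (Metric.closedBall z ε) δ (a δ) (b δ)|
          ≤ η * excTouchProb D.carrier (Metric.closedBall z ε) δ (a δ) (b δ)

/-- **Integrated form ("eight walks, five excursions" when `α = 5/8`)**: the Hadamard comparison,
telescoped over a growth of a macroscopic hull `A` by mesoscopic bumps, gives the finite restriction
formula `Z_{Ω∖A}/Z_Ω ≈ (H_{Ω∖A}/H_Ω)^α`; typed as the target statement of that telescoping (macroscopic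
obstacle = closed ball at a boundary point, for brevity). -/
def IntegratedComparison (α : ℝ) : Prop :=
  ∀ (D : DobrushinDomain) (a b : ℝ → Site 2), SAW.IsEndpointApprox D a b →
    ∀ z ∈ frontier D.carrier, z ≠ D.pt 0 → z ≠ D.pt 1 → ∀ r : ℝ, 0 < r →
      Metric.closedBall z r ∩ {D.pt 0, D.pt 1} = ∅ →
      Tendsto (fun δ : ℝ =>
          (1 - touchProb D.carrier (Metric.closedBall z r) δ (a δ) (b δ)) -
            (1 - excTouchProb D.carrier (Metric.closedBall z r) δ (a δ) (b δ)) ^ α)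
        (𝓝[>] (0 : ℝ)) (𝓝 0)

end Summit.CriticalPhenomena.SAWScalingLimit.Theses.SAWReversalUpgrade.HadamardTouching

end
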